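import Mathlib
import Summits.ValiantsHypothesis.ValiantsHypothesis.Theses.NewtonUnitEquations
import Summits.ValiantsHypothesis.ValiantsHypothesis.Theorems.NewtonUnitEquationsLogFactorBoundCruxEquiv
import Literature.Computability.AlgebraicComplexity.NewtonPolygonTauProofs

/-!
# `LogFactorBound` (stmt-ValiantsHypothesis-16048): what is trivially true, and the exact residual

Support file (prover, item stmt-ValiantsHypothesis-16048) for route NewtonUnitEquations, sequel of
`NewtonUnitEquationsLogFactorBoundCruxEquiv.lean` (which certifies that the item R1

  `LogFactorBound : ∃ b, ∀ k m t f, m ≤ ⌊log₂ k⌋ → (t-sparse) → vert (Σ_{i<k} Π_{j<m} f i j) ≤ (k t + 2)^b`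

is EQUIVALENT to the crux `NewtonTauWeak`, stmt-ValiantsHypothesis-5904).  Here the residual content of the
item is pinned down by proving everything the trivial monomial count gives:

* `vert_sum_prod_le` — the folklore count `vert (Σ_{i<k} Π_{j<m} f i j) ≤ k · t^m` (KPTT arXiv:1308.2286 §2,
  "trivial bound");
* `vert_sum_prod_le_pow_clog` — in the regime R1 (`2^m ≤ k`) that count is already QUASI-POLYNOMIAL with no
  work: `vert ≤ k^{⌈log₂ t⌉ + 1}` (from `t^m ≤ (2^m)^{⌈log₂ t⌉} ≤ k^{⌈log₂ t⌉}`), and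
  `vert_sum_prod_le_two_pow_mul` — the same in KPTT's printed Theorem-1 shape `2^{(m + log kt)^c}` at the
  boundary exponent `c = 2`: `vert ≤ 2^{(⌊log₂ k⌋+1)(⌈log₂ t⌉+1)}`.  KPTT's Theorem 1 needs `c < 2`; R1 asks for
  `c = 1`.  So the WHOLE content of the item is the passage from exponent `⌈log₂ t⌉ + 1` to a constant;
* `logFactorBound_fixed_t` — consequently R1 holds for every FIXED sparsity `t` (`b := ⌈log₂ t⌉ + 1`), and
  `logFactorBound_fixed_m` — for every FIXED number of factors `m` (`b := m + 1`, with no regime hypothesis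
  at all): the item is exactly the UNIFORMITY of `b` in `(m, t)` jointly (`k` is a slave parameter by the
  padding of the prequel: `k ↦ k + 2^m` is free);
* `logFactorBound_iff_kptt_newtonTauWeak` — the item, verbatim, is equivalent to the Literature's registered
  OPEN conjecture `Literature.Computability.AlgebraicComplexity.KPTT.newtonTauWeak` (`@[conjecture]`,
  `[status: open]`; KPTT 2015, sentence after Thm 1; Chatterjee–Gajjar–Tengse 2023 Conj. 1.3), by the prequel's
  `logFactorBound_iff_newtonTauWeak` and `Iff.rfl`;
* `logFactorBound_iff_diagonal`, `newtonTauWeak_iff_diagonal` (§4) — padding is free in ALL THREE parameters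
  (zero products, unit factors, sparsity budget), so the item and the crux are equivalent to a ONE-PARAMETER
  statement: sums of `n` products of `⌊log₂ n⌋` polynomials with `≤ n` monomials have `≤ (n+2)^b` Newton vertices
  (same `b`); `diagonal_quasiPoly` — that diagonal sequence is trivially `≤ n^{⌈log₂ n⌉+1}`.  KPTT's weak conjecture
  is therefore exactly "polynomial versus the trivial quasi-polynomial" for a single integer sequence.

No definitions (the padded family of §4 is an explicit `dite`), no named facts, no `sorry`.  [folklore; KPTT arXiv:1308.2286 §2 (trivial bound `k t^m`) and
Theorem 1 (hypothesis `2^{(m + log kt)^c}`, `c < 2`)]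
-/

-- the layout `Summit.<Summit>.<Sub>` repeats `ValiantsHypothesis` (single-conjunct summit, D-0017): silence dupNamespace
set_option linter.dupNamespace false

namespace Summit.ValiantsHypothesis.ValiantsHypothesis.Theorems.NewtonUnitEquationsLogFactorBound

open scoped BigOperators
open MvPolynomial
open Summit.ValiantsHypothesis.ValiantsHypothesis.Theses.NewtonUnitEquations (NewtonTauWeak)
open Summit.ValiantsHypothesis.ValiantsHypothesis.Theorems.NewtonTauWeak.Negative
  (vert vert_le_card_support vert_sum_fin_zero vert_sum_fin_zero')

/-! ## §1 The trivial monomial count -/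

/-- **Trivial bound** (KPTT §2): a sum of `k` products of `m` `t`-sparse polynomials has at most `k · t^m`
monomials, hence at most `k · t^m` Newton vertices. -/
theorem vert_sum_prod_le (k m t : ℕ) (f : Fin k → Fin m → MvPolynomial (Fin 2) ℂ)
    (hf : ∀ i j, (f i j).support.card ≤ t) : vert (∑ i, ∏ j, f i j) ≤ k * t ^ m := by
  refine (vert_le_card_support _).trans ?_
  calc (∑ i, ∏ j, f i j).support.card
      ≤ (Finset.univ.biUnion fun i : Fin k => (∏ j, f i j).support).card :=
        Finset.card_le_card MvPolynomial.support_sum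
    _ ≤ ∑ i, (∏ j, f i j).support.card := Finset.card_biUnion_le
    _ ≤ ∑ _i : Fin k, t ^ m := Finset.sum_le_sum fun i _ =>
        Literature.Computability.AlgebraicComplexity.KPTT.card_support_prod_univ_le_pow (f i) (hf i)
    _ = k * t ^ m := by simp

/-- **In the regime R1 the trivial count is quasi-polynomial for free**: if `m ≤ ⌊log₂ k⌋` (so `2^m ≤ k`)
then `vert (Σ_i Π_j f i j) ≤ k · t^m ≤ k · (2^m)^{⌈log₂ t⌉} ≤ k^{⌈log₂ t⌉ + 1}`. -/
theorem vert_sum_prod_le_pow_clog (k m t : ℕ) (f : Fin k → Fin m → MvPolynomial (Fin 2) ℂ)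
    (hm : m ≤ Nat.log 2 k) (hf : ∀ i j, (f i j).support.card ≤ t) :
    vert (∑ i, ∏ j, f i j) ≤ k ^ (Nat.clog 2 t + 1) := by
  rcases Nat.eq_zero_or_pos k with rfl | hk
  · rw [vert_sum_fin_zero]; exact Nat.zero_le _
  have h2m : 2 ^ m ≤ k :=
    (Nat.pow_le_pow_right Nat.two_pos hm).trans (Nat.pow_log_le_self 2 hk.ne')
  have ht : t ≤ 2 ^ Nat.clog 2 t := Nat.le_pow_clog one_lt_two t
  calc vert (∑ i, ∏ j, f i j) ≤ k * t ^ m := vert_sum_prod_le k m t f hf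
    _ ≤ k * (2 ^ Nat.clog 2 t) ^ m := Nat.mul_le_mul_left _ (Nat.pow_le_pow_left ht m)
    _ = k * (2 ^ m) ^ Nat.clog 2 t := by rw [← pow_mul, ← pow_mul, Nat.mul_comm m]
    _ ≤ k * k ^ Nat.clog 2 t := Nat.mul_le_mul_left _ (Nat.pow_le_pow_left h2m _)
    _ = k ^ (Nat.clog 2 t + 1) := by rw [pow_succ, Nat.mul_comm]

/-- **The boundary exponent `c = 2` of KPTT's printed Theorem 1 is free in R1**: for `m ≤ ⌊log₂ k⌋`,
`vert (Σ_i Π_j f i j) ≤ 2^{(⌊log₂ k⌋ + 1)·(⌈log₂ t⌉ + 1)}` — a bound of shape `2^{O((log kt)^2)} = 2^{O((m + log kt)^2)}`.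
(KPTT Thm 1 asks for `2^{(m + log kt)^c}` with `c < 2`; the item R1 is the case `c = 1`.) -/
theorem vert_sum_prod_le_two_pow_mul (k m t : ℕ) (f : Fin k → Fin m → MvPolynomial (Fin 2) ℂ)
    (hm : m ≤ Nat.log 2 k) (hf : ∀ i j, (f i j).support.card ≤ t) :
    vert (∑ i, ∏ j, f i j) ≤ 2 ^ ((Nat.log 2 k + 1) * (Nat.clog 2 t + 1)) := by
  have hk : k ≤ 2 ^ (Nat.log 2 k + 1) := (Nat.lt_pow_succ_log_self one_lt_two k).le
  calc vert (∑ i, ∏ j, f i j) ≤ k ^ (Nat.clog 2 t + 1) := vert_sum_prod_le_pow_clog k m t f hm hf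
    _ ≤ (2 ^ (Nat.log 2 k + 1)) ^ (Nat.clog 2 t + 1) := Nat.pow_le_pow_left hk _
    _ = 2 ^ ((Nat.log 2 k + 1) * (Nat.clog 2 t + 1)) := by rw [← pow_mul]

/-! ## §2 The item holds non-uniformly: for each fixed `t`, and for each fixed `m` -/

/-- **R1 for each fixed sparsity `t`** (with `b := ⌈log₂ t⌉ + 1`): the literal signature of
stmt-ValiantsHypothesis-16048 with the quantifier over `t` moved outside `∃ b`.  (`t = 0`: every factor is `0`,
so the sum is `0` for `m ≥ 1` and the constant `k` for `m = 0`.) -/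
theorem logFactorBound_fixed_t (t : ℕ) :
    ∃ b : ℕ, ∀ (k m : ℕ) (f : Fin k → Fin m → MvPolynomial (Fin 2) ℂ), m ≤ Nat.log 2 k →
      (∀ i j, (f i j).support.card ≤ t) →
        (Set.extremePoints ℝ (convexHull ℝ ((fun e : Fin 2 →₀ ℕ => fun i : Fin 2 => ((e i : ℕ) : ℝ)) ''
          ((∑ i, ∏ j, f i j).support : Set (Fin 2 →₀ ℕ))))).ncard ≤ (k * t + 2) ^ b := by
  refine ⟨Nat.clog 2 t + 1, fun k m f hm hf => ?_⟩
  show vert (∑ i, ∏ j, f i j) ≤ (k * t + 2) ^ (Nat.clog 2 t + 1)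
  have hbase : 1 ≤ k * t + 2 := by omega
  rcases Nat.eq_zero_or_pos t with rfl | ht
  · rcases Nat.eq_zero_or_pos m with rfl | hmpos
    · exact (vert_sum_fin_zero' k f).trans (Nat.one_le_pow _ _ hbase)
    · rw [sum_prod_eq_zero_of_sparsity_zero k m hmpos f hf, vert_zero]
      exact Nat.zero_le _
  have hkle : k ≤ k * t + 2 := by nlinarith
  calc vert (∑ i, ∏ j, f i j) ≤ k ^ (Nat.clog 2 t + 1) := vert_sum_prod_le_pow_clog k m t f hm hf
    _ ≤ (k * t + 2) ^ (Nat.clog 2 t + 1) := Nat.pow_le_pow_left hkle _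

/-- **For each fixed number of factors `m`** (with `b := m + 1`) the bound `(k t + 2)^b` holds with NO
regime hypothesis relating `k` and `m`: `vert ≤ k · t^m ≤ (k t + 2)·(k t + 2)^m`.  Together with
`logFactorBound_fixed_t` this shows that the content of the item is exactly the uniformity of `b` in `(m, t)`. -/
theorem logFactorBound_fixed_m (m : ℕ) :
    ∃ b : ℕ, ∀ (k t : ℕ) (f : Fin k → Fin m → MvPolynomial (Fin 2) ℂ),
      (∀ i j, (f i j).support.card ≤ t) →
        (Set.extremePoints ℝ (convexHull ℝ ((fun e : Fin 2 →₀ ℕ => fun i : Fin 2 => ((e i : ℕ) : ℝ)) ''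
          ((∑ i, ∏ j, f i j).support : Set (Fin 2 →₀ ℕ))))).ncard ≤ (k * t + 2) ^ b := by
  refine ⟨m + 1, fun k t f hf => ?_⟩
  show vert (∑ i, ∏ j, f i j) ≤ (k * t + 2) ^ (m + 1)
  have hbase : 1 ≤ k * t + 2 := by omega
  rcases Nat.eq_zero_or_pos m with rfl | hmpos
  · exact (vert_sum_fin_zero' k f).trans (Nat.one_le_pow _ _ hbase)
  rcases Nat.eq_zero_or_pos t with rfl | ht
  · rw [sum_prod_eq_zero_of_sparsity_zero k m hmpos f hf, vert_zero]
    exact Nat.zero_le _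
  have hkle : k ≤ k * t + 2 := by nlinarith
  have htle : t ≤ k * t + 2 ∨ k = 0 := by
    rcases Nat.eq_zero_or_pos k with rfl | hk
    · exact Or.inr rfl
    · exact Or.inl (by nlinarith)
  rcases htle with htle | rfl
  · calc vert (∑ i, ∏ j, f i j) ≤ k * t ^ m := vert_sum_prod_le k m t f hf
      _ ≤ (k * t + 2) * (k * t + 2) ^ m := Nat.mul_le_mul hkle (Nat.pow_le_pow_left htle m)
      _ = (k * t + 2) ^ (m + 1) := by rw [pow_succ, Nat.mul_comm]
  · rw [vert_sum_fin_zero]; exact Nat.zero_le _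

/-! ## §3 The item is the Literature's registered open conjecture -/

/-- **R1 ⟺ KPTT's weak Newton-polygon τ-conjecture by name**: the literal signature of
stmt-ValiantsHypothesis-16048 is equivalent to `Literature.Computability.AlgebraicComplexity.KPTT.newtonTauWeak`
(`@[conjecture]`, `[status: open]`: KPTT arXiv:1308.2286, sentence after Theorem 1; restated as open in
Chatterjee–Gajjar–Tengse 2023, Conjecture 1.3).  The item can therefore be settled only together with the crux
stmt-ValiantsHypothesis-5904 / that conjecture. -/
theorem logFactorBound_iff_kptt_newtonTauWeak :
    (∃ b : ℕ, ∀ (k m t : ℕ) (f : Fin k → Fin m → MvPolynomial (Fin 2) ℂ), m ≤ Nat.log 2 k →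
      (∀ i j, (f i j).support.card ≤ t) →
        (Set.extremePoints ℝ (convexHull ℝ ((fun e : Fin 2 →₀ ℕ => fun i : Fin 2 => ((e i : ℕ) : ℝ)) ''
          ((∑ i, ∏ j, f i j).support : Set (Fin 2 →₀ ℕ))))).ncard ≤ (k * t + 2) ^ b) ↔
    Literature.Computability.AlgebraicComplexity.KPTT.newtonTauWeak :=
  logFactorBound_iff_newtonTauWeak.trans Iff.rfl

/-! ## §4 The one-parameter (diagonal) normal form: `n` products, `⌊log₂ n⌋` factors, sparsity `n`

Padding is free in all three directions at once — zero products (`k ↑`), unit factors (`m ↑`, inside R1 as long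
as `m ≤ ⌊log₂ k⌋`) and the sparsity budget (`t ↑`, a hypothesis) — so the item collapses to a statement about a
single extremal function of ONE integer: `v(n) :=` the maximal number of Newton vertices of a sum of `n`
products of `⌊log₂ n⌋` bivariate polynomials with at most `n` monomials each.  R1 (hence the crux
`NewtonTauWeak`, hence KPTT's weak conjecture) says `v(n) ≤ (n+2)^b`; the trivial count
(`vert_sum_prod_le_pow_clog` at `k = t = n`) says `v(n) ≤ n^{⌈log₂ n⌉+1}`.  The padded family is written as an
explicit `dite` (no definition is introduced). -/

/-- Padding a product with unit factors, `dite` form: extending `g : Fin m → R` by `1` to `Fin M` (`m ≤ M`)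
does not change the product. -/
theorem prod_dite_pad {m M : ℕ} (hmM : m ≤ M) (g : Fin m → MvPolynomial (Fin 2) ℂ) :
    (∏ j : Fin M, (if hj : (j : ℕ) < m then g ⟨j, hj⟩ else (1 : MvPolynomial (Fin 2) ℂ))) = ∏ j, g j := by
  set c : ℕ → MvPolynomial (Fin 2) ℂ := fun j => if hj : j < m then g ⟨j, hj⟩ else 1 with hc
  have h1 : (∏ j : Fin M, (if hj : (j : ℕ) < m then g ⟨j, hj⟩ else (1 : MvPolynomial (Fin 2) ℂ))) =
      ∏ j : Fin M, c j := rfl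
  have h2 : (∏ j : Fin m, g j) = ∏ j : Fin m, c j :=
    Finset.prod_congr rfl fun j _ => by simp only [hc, dif_pos j.2, Fin.eta]
  rw [h1, h2, Fin.prod_univ_eq_prod_range c M, Fin.prod_univ_eq_prod_range c m]
  symm
  refine Finset.prod_subset (Finset.range_mono hmM) ?_
  intro j _ hjm
  rw [Finset.mem_range, not_lt] at hjm
  simp only [hc, dif_neg (not_lt.mpr hjm)]

/-- Padding a sum with zero summands, `dite` form: extending `P : Fin k → R` by `0` to `Fin K` (`k ≤ K`) does
not change the sum. -/
theorem sum_dite_pad {k K : ℕ} (hkK : k ≤ K) (P : Fin k → MvPolynomial (Fin 2) ℂ) :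
    (∑ i : Fin K, (if hi : (i : ℕ) < k then P ⟨i, hi⟩ else (0 : MvPolynomial (Fin 2) ℂ))) = ∑ i, P i := by
  set d : ℕ → MvPolynomial (Fin 2) ℂ := fun i => if hi : i < k then P ⟨i, hi⟩ else 0 with hd
  have h1 : (∑ i : Fin K, (if hi : (i : ℕ) < k then P ⟨i, hi⟩ else (0 : MvPolynomial (Fin 2) ℂ))) =
      ∑ i : Fin K, d i := rfl
  have h2 : (∑ i : Fin k, P i) = ∑ i : Fin k, d i :=
    Finset.sum_congr rfl fun i _ => by simp only [hd, dif_pos i.2, Fin.eta]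
  rw [h1, h2, Fin.sum_univ_eq_sum_range d K, Fin.sum_univ_eq_sum_range d k]
  symm
  refine Finset.sum_subset (Finset.range_mono hkK) ?_
  intro i _ hik
  rw [Finset.mem_range, not_lt] at hik
  simp only [hd, dif_neg (not_lt.mpr hik)]

/-- **Two-way padding, `dite` form.**  Extending `f : Fin k → Fin m → R` to `Fin K → Fin M` (`k ≤ K`,
`m ≤ M`, `0 < M`) by ZERO rows `i ≥ k` and UNIT columns `j ≥ m` does not change `Σ_i Π_j f i j`. -/
theorem sum_prod_dite_pad {k K m M : ℕ} (hkK : k ≤ K) (hmM : m ≤ M) (hM : 0 < M)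
    (f : Fin k → Fin m → MvPolynomial (Fin 2) ℂ) :
    (∑ i : Fin K, ∏ j : Fin M, (if hi : (i : ℕ) < k then
        (if hj : (j : ℕ) < m then f ⟨i, hi⟩ ⟨j, hj⟩ else (1 : MvPolynomial (Fin 2) ℂ)) else 0)) =
      ∑ i, ∏ j, f i j := by
  have key : ∀ i : Fin K, (∏ j : Fin M, (if hi : (i : ℕ) < k then
      (if hj : (j : ℕ) < m then f ⟨i, hi⟩ ⟨j, hj⟩ else (1 : MvPolynomial (Fin 2) ℂ)) else 0)) =
        if hi : (i : ℕ) < k then ∏ j, f ⟨i, hi⟩ j else 0 := by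
    intro i
    by_cases hi : (i : ℕ) < k
    · simp only [dif_pos hi]
      exact prod_dite_pad hmM (f ⟨i, hi⟩)
    · simp only [dif_neg hi]
      exact Finset.prod_eq_zero (Finset.mem_univ (⟨0, hM⟩ : Fin M)) rfl
  rw [Finset.sum_congr rfl fun i _ => key i]
  exact sum_dite_pad hkK (fun i => ∏ j, f i j)

/-- The two-way padded family is `t`-sparse as soon as `t ≥ 1` (entries: some `f i j`, or `1`, or `0`). -/
theorem sparse_dite_pad {k K m M t : ℕ} (ht : 1 ≤ t) (f : Fin k → Fin m → MvPolynomial (Fin 2) ℂ)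
    (hf : ∀ i j, (f i j).support.card ≤ t) (i : Fin K) (j : Fin M) :
    (if hi : (i : ℕ) < k then (if hj : (j : ℕ) < m then f ⟨i, hi⟩ ⟨j, hj⟩ else (1 : MvPolynomial (Fin 2) ℂ))
      else 0).support.card ≤ t := by
  by_cases hi : (i : ℕ) < k
  · by_cases hj : (j : ℕ) < m
    · simp only [dif_pos hi, dif_pos hj]
      exact hf _ _
    · simp only [dif_pos hi, dif_neg hj]
      rw [MvPolynomial.support_one, Finset.card_singleton]
      exact ht
  · simp only [dif_neg hi, MvPolynomial.support_zero, Finset.card_empty]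
    exact Nat.zero_le _

/-- **Diagonal normal form of R1 (and of the crux).**  `LogFactorBound` (stmt-ValiantsHypothesis-16048, verbatim
on the left) is equivalent to its one-parameter diagonal `k = t = n`, `m = ⌊log₂ n⌋`:
sums of `n` products of `⌊log₂ n⌋` bivariate polynomials with `≤ n` monomials each have `≤ (n + 2)^b` Newton
vertices.  (`→`: specialise and use `n² + 2 ≤ (n+2)²`, constant `2b`; `←`: given `k, m, t, f` with `m ≤ ⌊log₂ k⌋`,
pad to `n := k·t` products and `⌊log₂ (k t)⌋` factors — `sum_prod_dite_pad`, sparsity `t ≤ k t` — and read off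
`(k t + 2)^b` with the SAME `b`; the corners `m = 0`, `t = 0`, `k = 0` are trivial.)  With the prequel, KPTT's weak
conjecture is thus the assertion that ONE integer sequence grows polynomially rather than like the trivial
`n^{⌈log₂ n⌉+1}` (`vert_sum_prod_le_pow_clog`). -/
theorem logFactorBound_iff_diagonal :
    (∃ b : ℕ, ∀ (k m t : ℕ) (f : Fin k → Fin m → MvPolynomial (Fin 2) ℂ), m ≤ Nat.log 2 k →
      (∀ i j, (f i j).support.card ≤ t) →
        (Set.extremePoints ℝ (convexHull ℝ ((fun e : Fin 2 →₀ ℕ => fun i : Fin 2 => ((e i : ℕ) : ℝ)) ''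
          ((∑ i, ∏ j, f i j).support : Set (Fin 2 →₀ ℕ))))).ncard ≤ (k * t + 2) ^ b) ↔
    (∃ b : ℕ, ∀ (n : ℕ) (g : Fin n → Fin (Nat.log 2 n) → MvPolynomial (Fin 2) ℂ),
      (∀ i j, (g i j).support.card ≤ n) →
        (Set.extremePoints ℝ (convexHull ℝ ((fun e : Fin 2 →₀ ℕ => fun i : Fin 2 => ((e i : ℕ) : ℝ)) ''
          ((∑ i, ∏ j, g i j).support : Set (Fin 2 →₀ ℕ))))).ncard ≤ (n + 2) ^ b) := by
  constructor
  · rintro ⟨b, h⟩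
    refine ⟨2 * b, fun n g hg => ?_⟩
    have hsq : n * n + 2 ≤ (n + 2) ^ 2 := by nlinarith
    calc vert (∑ i, ∏ j, g i j) ≤ (n * n + 2) ^ b := h n (Nat.log 2 n) n g le_rfl hg
      _ ≤ ((n + 2) ^ 2) ^ b := Nat.pow_le_pow_left hsq b
      _ = (n + 2) ^ (2 * b) := by rw [← pow_mul]
  · rintro ⟨b, h⟩
    refine ⟨b, fun k m t f hm hf => ?_⟩
    show vert (∑ i, ∏ j, f i j) ≤ (k * t + 2) ^ b
    have hbase : 1 ≤ k * t + 2 := by omega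
    rcases Nat.eq_zero_or_pos m with rfl | hmpos
    · exact (vert_sum_fin_zero' k f).trans (Nat.one_le_pow _ _ hbase)
    rcases Nat.eq_zero_or_pos t with rfl | ht
    · rw [sum_prod_eq_zero_of_sparsity_zero k m hmpos f hf, vert_zero]
      exact Nat.zero_le _
    rcases Nat.eq_zero_or_pos k with rfl | hk
    · rw [vert_sum_fin_zero]; exact Nat.zero_le _
    -- pad to `n := k * t` products and `⌊log₂ (k t)⌋` factors
    have hkK : k ≤ k * t := Nat.le_mul_of_pos_right k ht
    have htK : t ≤ k * t := Nat.le_mul_of_pos_left t hk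
    have hmM : m ≤ Nat.log 2 (k * t) := hm.trans (Nat.log_mono_right hkK)
    have hM : 0 < Nat.log 2 (k * t) := hmpos.trans_le hmM
    have hle := h (k * t) (fun i j => if hi : (i : ℕ) < k then
        (if hj : (j : ℕ) < m then f ⟨i, hi⟩ ⟨j, hj⟩ else (1 : MvPolynomial (Fin 2) ℂ)) else 0)
      (fun i j => (sparse_dite_pad ht f hf i j).trans htK)
    rw [sum_prod_dite_pad hkK hmM hM f] at hle
    exact hle

/-- **The crux in diagonal form**: `NewtonTauWeak` (stmt-ValiantsHypothesis-5904) is equivalent to the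
one-parameter statement of `logFactorBound_iff_diagonal`. -/
theorem newtonTauWeak_iff_diagonal :
    NewtonTauWeak ↔
    (∃ b : ℕ, ∀ (n : ℕ) (g : Fin n → Fin (Nat.log 2 n) → MvPolynomial (Fin 2) ℂ),
      (∀ i j, (g i j).support.card ≤ n) →
        (Set.extremePoints ℝ (convexHull ℝ ((fun e : Fin 2 →₀ ℕ => fun i : Fin 2 => ((e i : ℕ) : ℝ)) ''
          ((∑ i, ∏ j, g i j).support : Set (Fin 2 →₀ ℕ))))).ncard ≤ (n + 2) ^ b) :=
  logFactorBound_iff_newtonTauWeak.symm.trans logFactorBound_iff_diagonal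

/-- **The diagonal sequence is trivially quasi-polynomial**: every diagonal instance has
`≤ n^{⌈log₂ n⌉ + 1}` Newton vertices (`vert_sum_prod_le_pow_clog` at `k = t = n`, `m = ⌊log₂ n⌋`). -/
theorem diagonal_quasiPoly (n : ℕ) (g : Fin n → Fin (Nat.log 2 n) → MvPolynomial (Fin 2) ℂ)
    (hg : ∀ i j, (g i j).support.card ≤ n) :
    vert (∑ i, ∏ j, g i j) ≤ n ^ (Nat.clog 2 n + 1) :=
  vert_sum_prod_le_pow_clog n (Nat.log 2 n) n g le_rfl hg

end Summit.ValiantsHypothesis.ValiantsHypothesis.Theorems.NewtonUnitEquationsLogFactorBound
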